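import Mathlib.NumberTheory.Padics.PadicIntegers
import Mathlib.GroupTheory.Torsion
import HarnessLib

set_option linter.dupNamespace false
set_option autoImplicit false

/-!
# K7r crux `EllipticUnitValueSevenOfGZK` (stmt-BirchSwinnertonDyer-19945), line `rubin-formula-zp`, stub
# S_sat-Zp — the ABSTRACT «TWO-GENERATOR DESCENT»: a saturated, `ℤ_p`-stable subgroup containing two
# independent elements exhausts a subgroup which is, up to torsion and a finite index, spanned over `ℤ_p`
# by two elements (pure group theory; cell `bsd-cm`, seat `bsd-cm-k7r-c4` g6; helper, `--supports` 19945)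

HONEST FRAMING. Nothing here is about elliptic curves; nothing is asserted about the crux; BSD is not
proved by any of this. This is the group-theoretic heart of the RANK ROUTE to the saturation stub S_sat-Zp
(`X12.O11.RamifiedCMBottomSaturationAtZp`; memo MEMO-k7r-c4-g6-CONTINUATION.md §4): with
`A = ∏_k H¹(K, E[p^k])`, `act = padicPi` (the `ℤ_p`-action), `S = S_{p,rel}(E/K)`, `M = E(K) ⊗ ℤ_p`
(the Mordell–Weil Kummer span), `z₁, z₂` the two `ℤ_p`-generators of `𝒪_𝔭 · z(𝟙)` (from «`End_K(E)` is
two-generated», Silverman AEC III.9.4) and `p^{c₀} = [S : tors ⊔ 𝒪_𝔭 · z(𝟙)]` (the bottom index exponent),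
`m₁, m₂` two Mordell–Weil Kummer classes independent modulo torsion (the `±`-chart), it yields `S ≤ M`.

THE STATEMENT (`le_of_twoGenerator_descent`; elementwise variant `le_of_twoGenerator_descent_of_exists_zsmul`, §3). Let `A` be an additive commutative group with maps
`act c : A →+ A` (`c ∈ ℤ_p`) satisfying `act 1 = id`, `act (cd) = act c ∘ act d`,
`act (c + d) x = act c x + act d x`. Let `M ≤ S ≤ A` with `M` stable under every `act c` and SATURATED in
`S` (`x ∈ S`, `n ≠ 0`, `n • x ∈ M ⇒ x ∈ M`). Suppose every `a ∈ S` has `p^{c₀} • a = t + act u z₁ + act v z₂`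
with `t` of finite order, and `M` contains `m₁, m₂` with «`act u m₁ + act v m₂` of finite order ⇒
`u = v = 0`». THEN `S ≤ M`. PROOF: write `N₀ • m_j = act α_j z₁ + act β_j z₂` (`N₀ ≠ 0` kills the torsion
parts); the determinant `Δ = α₁β₂ − α₂β₁` is non-zero (a vanishing `Δ` gives a non-trivial relation
`act (N₀u) m₁ + act (N₀v) m₂ = 0`); Cramer's rule puts `act Δ z_i` in `M`; `Δ = p^e · unit` puts
`p^e • z_i` in `M`; hence a non-zero multiple of every `a ∈ S` lies in `M`, and saturation concludes.
References: B. Perrin-Riou, Bull. SMF 115 (1987) §0 p. 401 (the `ℤ_p`-module `S_p(L)`);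
J. H. Silverman, *AEC* (2009) Cor. III.9.4; cell memo MEMO-k7r-c4-g6-CONTINUATION.md §4.
-/

namespace Summit.BirchSwinnertonDyer.BirchSwinnertonDyer.Theorems.RamifiedSevenEllipticUnits.TwoGeneratorDescent

variable {A : Type*} [AddCommGroup A] {p : ℕ} [Fact p.Prime] (act : ℤ_[p] → A →+ A)

/-! ## §1 Arithmetic of an additive `ℤ_p`-action given by the three laws -/

section Laws

variable (hadd : ∀ (c d : ℤ_[p]) (x : A), act (c + d) x = act c x + act d x)
include hadd

/-- `act 0 = 0`. [cite: PerrinRiou1987BSMF, §0 p. 401 (the `ℤ_p`-module structure of `S_p(L)`)] -/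
theorem act_zero (x : A) : act 0 x = 0 := by
  have h := hadd 0 0 x
  rw [add_zero] at h
  exact left_eq_add.mp h

/-- `act (-c) x = - act c x`. [cite: PerrinRiou1987BSMF, §0 p. 401 (the `ℤ_p`-module structure of `S_p(L)`)] -/
theorem act_neg (c : ℤ_[p]) (x : A) : act (-c) x = -act c x := by
  have h := hadd c (-c) x
  rw [add_neg_cancel, act_zero act hadd] at h
  exact (neg_eq_of_add_eq_zero_right h.symm).symm

/-- `act (c - d) x = act c x - act d x`. [cite: PerrinRiou1987BSMF, §0 p. 401 (the `ℤ_p`-module structure of `S_p(L)`)] -/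
theorem act_sub (c d : ℤ_[p]) (x : A) : act (c - d) x = act c x - act d x := by
  rw [sub_eq_add_neg, hadd, act_neg act hadd, sub_eq_add_neg]

variable (h1 : ∀ x : A, act 1 x = x)
include h1

/-- `act n x = n • x` for `n ∈ ℕ`. [cite: PerrinRiou1987BSMF, §0 p. 401 (the `ℤ_p`-module structure of `S_p(L)`)] -/
theorem act_natCast (n : ℕ) (x : A) : act (n : ℤ_[p]) x = n • x := by
  induction n with
  | zero => rw [Nat.cast_zero, act_zero act hadd, zero_smul]
  | succ n ih => rw [Nat.cast_succ, hadd, ih, h1, succ_nsmul]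

/-- `act n x = n • x` for `n ∈ ℤ`. [cite: PerrinRiou1987BSMF, §0 p. 401 (the `ℤ_p`-module structure of `S_p(L)`)] -/
theorem act_intCast (n : ℤ) (x : A) : act (n : ℤ_[p]) x = n • x := by
  obtain ⟨m, rfl | rfl⟩ := Int.eq_nat_or_neg n
  · rw [Int.cast_natCast, act_natCast act hadd h1, natCast_zsmul]
  · rw [Int.cast_neg, Int.cast_natCast, act_neg act hadd, act_natCast act hadd h1, neg_zsmul,
      natCast_zsmul]

end Laws

/-! ## §2 The two-generator descent -/

/-- Solving a vanishing `2 × 2` determinant over a domain: if `α₁ β₂ = α₂ β₁` then some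
`(u, v) ≠ (0, 0)` has `u α₁ + v α₂ = 0` and `u β₁ + v β₂ = 0`. [folklore] -/
theorem exists_ne_zero_of_det_eq_zero {R : Type*} [CommRing R] [Nontrivial R] (α₁ β₁ α₂ β₂ : R)
    (h : α₁ * β₂ - α₂ * β₁ = 0) :
    ∃ u v : R, (u ≠ 0 ∨ v ≠ 0) ∧ u * α₁ + v * α₂ = 0 ∧ u * β₁ + v * β₂ = 0 := by
  by_cases hα : α₁ = 0
  · by_cases hβ : β₁ = 0
    · exact ⟨1, 0, Or.inl one_ne_zero, by rw [hα]; ring, by rw [hβ]; ring⟩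
    · refine ⟨-β₂, β₁, Or.inr hβ, ?_, by ring⟩
      linear_combination (-1 : R) * h
  · refine ⟨-α₂, α₁, Or.inr hα, by ring, ?_⟩
    linear_combination h

/-- **THE TWO-GENERATOR DESCENT** (module docstring). [cite: PerrinRiou1987BSMF, §0 p. 401 (the `ℤ_p`-module `S_p(L)`; shape only)]
[cite: SilvermanAEC2009, Cor. III.9.4 (the source of the two generators; shape only)] -/
theorem le_of_twoGenerator_descent
    (h1 : ∀ x : A, act 1 x = x) (hmul : ∀ (c d : ℤ_[p]) (x : A), act (c * d) x = act c (act d x))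
    (hadd : ∀ (c d : ℤ_[p]) (x : A), act (c + d) x = act c x + act d x)
    (S M : AddSubgroup A) (hMS : M ≤ S) (hMact : ∀ (c : ℤ_[p]), ∀ x ∈ M, act c x ∈ M)
    (hsat : ∀ x ∈ S, ∀ n : ℕ, n ≠ 0 → n • x ∈ M → x ∈ M)
    (z₁ z₂ : A) (c₀ : ℕ)
    (hS : ∀ a ∈ S, ∃ t : A, IsOfFinAddOrder t ∧ ∃ u v : ℤ_[p], (p ^ c₀) • a = t + act u z₁ + act v z₂)
    (m₁ m₂ : A) (hm₁ : m₁ ∈ M) (hm₂ : m₂ ∈ M)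
    (hind : ∀ u v : ℤ_[p], IsOfFinAddOrder (act u m₁ + act v m₂) → u = 0 ∧ v = 0) :
    S ≤ M := by
  have hp : p.Prime := Fact.out
  -- §2.1 kill the torsion parts of the expansions of `m₁`, `m₂`
  have hkill : ∀ a ∈ S, ∃ n : ℕ, n ≠ 0 ∧ ∃ u v : ℤ_[p], n • a = act u z₁ + act v z₂ := by
    intro a ha
    obtain ⟨t, ht, u, v, h⟩ := hS a ha
    refine ⟨addOrderOf t * p ^ c₀, mul_ne_zero (addOrderOf_pos_iff.2 ht).ne' (pow_ne_zero _ hp.ne_zero),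
      (addOrderOf t : ℤ_[p]) * u, (addOrderOf t : ℤ_[p]) * v, ?_⟩
    rw [mul_nsmul', h, nsmul_add, nsmul_add, addOrderOf_nsmul_eq_zero, zero_add, hmul, hmul,
      act_natCast act hadd h1, act_natCast act hadd h1]
  obtain ⟨n₁, hn₁, u₁, v₁, h₁⟩ := hkill m₁ (hMS hm₁)
  obtain ⟨n₂, hn₂, u₂, v₂, h₂⟩ := hkill m₂ (hMS hm₂)
  -- common multiple `N₀ = n₁ n₂`
  set N₀ : ℕ := n₁ * n₂ with hN₀
  have hN₀0 : N₀ ≠ 0 := mul_ne_zero hn₁ hn₂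
  have hN₀Z : (N₀ : ℤ_[p]) ≠ 0 := Nat.cast_ne_zero.2 hN₀0
  set α₁ : ℤ_[p] := (n₂ : ℤ_[p]) * u₁
  set β₁ : ℤ_[p] := (n₂ : ℤ_[p]) * v₁
  set α₂ : ℤ_[p] := (n₁ : ℤ_[p]) * u₂
  set β₂ : ℤ_[p] := (n₁ : ℤ_[p]) * v₂
  have e₁ : N₀ • m₁ = act α₁ z₁ + act β₁ z₂ := by
    rw [hN₀, mul_comm, mul_nsmul', h₁, nsmul_add, hmul, hmul, act_natCast act hadd h1,
      act_natCast act hadd h1]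
  have e₂ : N₀ • m₂ = act α₂ z₁ + act β₂ z₂ := by
    rw [hN₀, mul_nsmul', h₂, nsmul_add, hmul, hmul, act_natCast act hadd h1, act_natCast act hadd h1]
  -- §2.2 the determinant is non-zero
  set Δ : ℤ_[p] := α₁ * β₂ - α₂ * β₁ with hΔ
  have hΔ0 : Δ ≠ 0 := by
    intro h0
    obtain ⟨u, v, huv, hα, hβ⟩ := exists_ne_zero_of_det_eq_zero α₁ β₁ α₂ β₂ h0
    have hrel : act (u * N₀) m₁ + act (v * N₀) m₂ = 0 := by
      rw [hmul, hmul, act_natCast act hadd h1, act_natCast act hadd h1, e₁, e₂, map_add, map_add,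
        ← hmul, ← hmul, ← hmul, ← hmul]
      calc act (u * α₁) z₁ + act (u * β₁) z₂ + (act (v * α₂) z₁ + act (v * β₂) z₂)
          = act (u * α₁ + v * α₂) z₁ + act (u * β₁ + v * β₂) z₂ := by rw [hadd, hadd]; abel
        _ = 0 := by rw [hα, hβ, act_zero act hadd, act_zero act hadd, add_zero]
    have h00 := hind (u * N₀) (v * N₀) (by rw [hrel]; exact IsOfFinAddOrder.zero)
    rcases huv with hu | hv
    · exact hu ((mul_eq_zero.1 h00.1).resolve_right hN₀Z)
    · exact hv ((mul_eq_zero.1 h00.2).resolve_right hN₀Z)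
  -- §2.3 Cramer: `act Δ z₁`, `act Δ z₂ ∈ M`
  have hN₀m₁ : N₀ • m₁ ∈ M := M.nsmul_mem hm₁ N₀
  have hN₀m₂ : N₀ • m₂ ∈ M := M.nsmul_mem hm₂ N₀
  have hΔz₁ : act Δ z₁ ∈ M := by
    have h : act Δ z₁ = act β₂ (N₀ • m₁) - act β₁ (N₀ • m₂) := by
      rw [e₁, e₂, map_add, map_add, ← hmul, ← hmul, ← hmul, ← hmul, hΔ, act_sub act hadd]
      have hc : β₂ * β₁ = β₁ * β₂ := mul_comm _ _
      rw [show β₂ * α₁ = α₁ * β₂ from mul_comm _ _, show β₁ * α₂ = α₂ * β₁ from mul_comm _ _, hc]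
      abel
    rw [h]
    exact M.sub_mem (hMact _ _ hN₀m₁) (hMact _ _ hN₀m₂)
  have hΔz₂ : act Δ z₂ ∈ M := by
    have h : act Δ z₂ = act α₁ (N₀ • m₂) - act α₂ (N₀ • m₁) := by
      rw [e₁, e₂, map_add, map_add, ← hmul, ← hmul, ← hmul, ← hmul, hΔ, act_sub act hadd]
      rw [show α₂ * α₁ = α₁ * α₂ from mul_comm _ _]
      abel
    rw [h]
    exact M.sub_mem (hMact _ _ hN₀m₂) (hMact _ _ hN₀m₁)
  -- §2.4 `Δ = unit · p^e`, so `p^e • z_i ∈ M`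
  set e : ℕ := Δ.valuation with he
  have hpe : ∀ z : A, act Δ z ∈ M → (p ^ e) • z ∈ M := by
    intro z hz
    have hunit := PadicInt.unitCoeff_spec hΔ0
    have hΔ' : ((((PadicInt.unitCoeff hΔ0)⁻¹ : ℤ_[p]ˣ) : ℤ_[p]) * Δ) = (p : ℤ_[p]) ^ e := by
      calc ((((PadicInt.unitCoeff hΔ0)⁻¹ : ℤ_[p]ˣ) : ℤ_[p]) * Δ)
          = (((PadicInt.unitCoeff hΔ0)⁻¹ : ℤ_[p]ˣ) : ℤ_[p]) *
              ((PadicInt.unitCoeff hΔ0 : ℤ_[p]) * (p : ℤ_[p]) ^ Δ.valuation) := by rw [← hunit]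
        _ = (p : ℤ_[p]) ^ e := by rw [← mul_assoc, Units.inv_mul, one_mul]
    have h : (p ^ e) • z = act (((PadicInt.unitCoeff hΔ0)⁻¹ : ℤ_[p]ˣ) : ℤ_[p]) (act Δ z) := by
      rw [← hmul, hΔ', ← Nat.cast_pow, act_natCast act hadd h1]
    rw [h]
    exact hMact _ _ hz
  have hz₁ : (p ^ e) • z₁ ∈ M := hpe z₁ hΔz₁
  have hz₂ : (p ^ e) • z₂ ∈ M := hpe z₂ hΔz₂
  -- §2.5 conclusion by saturation
  intro a ha
  obtain ⟨n, hn, u, v, h⟩ := hkill a ha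
  refine hsat a ha (p ^ e * n) (mul_ne_zero (pow_ne_zero _ hp.ne_zero) hn) ?_
  rw [mul_nsmul', h, nsmul_add, ← map_nsmul, ← map_nsmul]
  exact M.add_mem (hMact _ _ hz₁) (hMact _ _ hz₂)

/-! ## §3 The same descent from ELEMENTWISE relations `N • a = act u z₁ + act v z₂` (`N ≠ 0` depending on `a`)
(the shape delivered by `RelaxedEqCompactRank.exists_zsmul_eq_pair_of_mem_relaxed`, seat k7r-c2 g5, from the
bottom index exponent and the PROVED «`End_K(E)` has rank ≤ 2 up to an integer»
`EndRankTwo.exists_generator_endRing` — so that no named fact is needed) -/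

/-- **THE TWO-GENERATOR DESCENT, elementwise form.** As `le_of_twoGenerator_descent`, but the expansion
hypothesis is: every `a ∈ S` has SOME non-zero integer `N` with `N • a = act u z₁ + act v z₂` (no uniform
exponent, no torsion term). Proof identical after the torsion-killing step (an integer multiple is turned
into a natural one with `Int.sign`). [cite: PerrinRiou1987BSMF, §0 p. 401 (the `ℤ_p`-module `S_p(L)`; shape only)]
[cite: SilvermanAEC2009, Cor. III.9.4 (the source of the two generators; shape only)] -/
theorem le_of_twoGenerator_descent_of_exists_zsmul
    (h1 : ∀ x : A, act 1 x = x) (hmul : ∀ (c d : ℤ_[p]) (x : A), act (c * d) x = act c (act d x))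
    (hadd : ∀ (c d : ℤ_[p]) (x : A), act (c + d) x = act c x + act d x)
    (S M : AddSubgroup A) (hMS : M ≤ S) (hMact : ∀ (c : ℤ_[p]), ∀ x ∈ M, act c x ∈ M)
    (hsat : ∀ x ∈ S, ∀ n : ℕ, n ≠ 0 → n • x ∈ M → x ∈ M)
    (z₁ z₂ : A)
    (hS : ∀ a ∈ S, ∃ N : ℤ, N ≠ 0 ∧ ∃ u v : ℤ_[p], N • a = act u z₁ + act v z₂)
    (m₁ m₂ : A) (hm₁ : m₁ ∈ M) (hm₂ : m₂ ∈ M)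
    (hind : ∀ u v : ℤ_[p], IsOfFinAddOrder (act u m₁ + act v m₂) → u = 0 ∧ v = 0) :
    S ≤ M := by
  have hp : p.Prime := Fact.out
  -- §3.1 natural-number multiples
  have hkill : ∀ a ∈ S, ∃ n : ℕ, n ≠ 0 ∧ ∃ u v : ℤ_[p], n • a = act u z₁ + act v z₂ := by
    intro a ha
    obtain ⟨N, hN, u, v, h⟩ := hS a ha
    refine ⟨N.natAbs, Int.natAbs_ne_zero.2 hN, (N.sign : ℤ_[p]) * u, (N.sign : ℤ_[p]) * v, ?_⟩
    rw [← natCast_zsmul, ← Int.sign_mul_self_eq_natAbs, mul_zsmul, h, zsmul_add, hmul, hmul,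
      act_intCast act hadd h1, act_intCast act hadd h1]
  obtain ⟨n₁, hn₁, u₁, v₁, h₁⟩ := hkill m₁ (hMS hm₁)
  obtain ⟨n₂, hn₂, u₂, v₂, h₂⟩ := hkill m₂ (hMS hm₂)
  -- common multiple `N₀ = n₁ n₂`
  set N₀ : ℕ := n₁ * n₂ with hN₀
  have hN₀0 : N₀ ≠ 0 := mul_ne_zero hn₁ hn₂
  have hN₀Z : (N₀ : ℤ_[p]) ≠ 0 := Nat.cast_ne_zero.2 hN₀0
  set α₁ : ℤ_[p] := (n₂ : ℤ_[p]) * u₁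
  set β₁ : ℤ_[p] := (n₂ : ℤ_[p]) * v₁
  set α₂ : ℤ_[p] := (n₁ : ℤ_[p]) * u₂
  set β₂ : ℤ_[p] := (n₁ : ℤ_[p]) * v₂
  have e₁ : N₀ • m₁ = act α₁ z₁ + act β₁ z₂ := by
    rw [hN₀, mul_comm, mul_nsmul', h₁, nsmul_add, hmul, hmul, act_natCast act hadd h1,
      act_natCast act hadd h1]
  have e₂ : N₀ • m₂ = act α₂ z₁ + act β₂ z₂ := by
    rw [hN₀, mul_nsmul', h₂, nsmul_add, hmul, hmul, act_natCast act hadd h1, act_natCast act hadd h1]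
  -- §3.2 the determinant is non-zero
  set Δ : ℤ_[p] := α₁ * β₂ - α₂ * β₁ with hΔ
  have hΔ0 : Δ ≠ 0 := by
    intro h0
    obtain ⟨u, v, huv, hα, hβ⟩ := exists_ne_zero_of_det_eq_zero α₁ β₁ α₂ β₂ h0
    have hrel : act (u * N₀) m₁ + act (v * N₀) m₂ = 0 := by
      rw [hmul, hmul, act_natCast act hadd h1, act_natCast act hadd h1, e₁, e₂, map_add, map_add,
        ← hmul, ← hmul, ← hmul, ← hmul]
      calc act (u * α₁) z₁ + act (u * β₁) z₂ + (act (v * α₂) z₁ + act (v * β₂) z₂)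
          = act (u * α₁ + v * α₂) z₁ + act (u * β₁ + v * β₂) z₂ := by rw [hadd, hadd]; abel
        _ = 0 := by rw [hα, hβ, act_zero act hadd, act_zero act hadd, add_zero]
    have h00 := hind (u * N₀) (v * N₀) (by rw [hrel]; exact IsOfFinAddOrder.zero)
    rcases huv with hu | hv
    · exact hu ((mul_eq_zero.1 h00.1).resolve_right hN₀Z)
    · exact hv ((mul_eq_zero.1 h00.2).resolve_right hN₀Z)
  -- §3.3 Cramer: `act Δ z₁`, `act Δ z₂ ∈ M`
  have hN₀m₁ : N₀ • m₁ ∈ M := M.nsmul_mem hm₁ N₀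
  have hN₀m₂ : N₀ • m₂ ∈ M := M.nsmul_mem hm₂ N₀
  have hΔz₁ : act Δ z₁ ∈ M := by
    have h : act Δ z₁ = act β₂ (N₀ • m₁) - act β₁ (N₀ • m₂) := by
      rw [e₁, e₂, map_add, map_add, ← hmul, ← hmul, ← hmul, ← hmul, hΔ, act_sub act hadd]
      have hc : β₂ * β₁ = β₁ * β₂ := mul_comm _ _
      rw [show β₂ * α₁ = α₁ * β₂ from mul_comm _ _, show β₁ * α₂ = α₂ * β₁ from mul_comm _ _, hc]
      abel
    rw [h]
    exact M.sub_mem (hMact _ _ hN₀m₁) (hMact _ _ hN₀m₂)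
  have hΔz₂ : act Δ z₂ ∈ M := by
    have h : act Δ z₂ = act α₁ (N₀ • m₂) - act α₂ (N₀ • m₁) := by
      rw [e₁, e₂, map_add, map_add, ← hmul, ← hmul, ← hmul, ← hmul, hΔ, act_sub act hadd]
      rw [show α₂ * α₁ = α₁ * α₂ from mul_comm _ _]
      abel
    rw [h]
    exact M.sub_mem (hMact _ _ hN₀m₂) (hMact _ _ hN₀m₁)
  -- §3.4 `Δ = unit · p^e`, so `p^e • z_i ∈ M`
  set e : ℕ := Δ.valuation with he
  have hpe : ∀ z : A, act Δ z ∈ M → (p ^ e) • z ∈ M := by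
    intro z hz
    have hunit := PadicInt.unitCoeff_spec hΔ0
    have hΔ' : ((((PadicInt.unitCoeff hΔ0)⁻¹ : ℤ_[p]ˣ) : ℤ_[p]) * Δ) = (p : ℤ_[p]) ^ e := by
      calc ((((PadicInt.unitCoeff hΔ0)⁻¹ : ℤ_[p]ˣ) : ℤ_[p]) * Δ)
          = (((PadicInt.unitCoeff hΔ0)⁻¹ : ℤ_[p]ˣ) : ℤ_[p]) *
              ((PadicInt.unitCoeff hΔ0 : ℤ_[p]) * (p : ℤ_[p]) ^ Δ.valuation) := by rw [← hunit]
        _ = (p : ℤ_[p]) ^ e := by rw [← mul_assoc, Units.inv_mul, one_mul]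
    have h : (p ^ e) • z = act (((PadicInt.unitCoeff hΔ0)⁻¹ : ℤ_[p]ˣ) : ℤ_[p]) (act Δ z) := by
      rw [← hmul, hΔ', ← Nat.cast_pow, act_natCast act hadd h1]
    rw [h]
    exact hMact _ _ hz
  have hz₁ : (p ^ e) • z₁ ∈ M := hpe z₁ hΔz₁
  have hz₂ : (p ^ e) • z₂ ∈ M := hpe z₂ hΔz₂
  -- §3.5 conclusion by saturation
  intro a ha
  obtain ⟨n, hn, u, v, h⟩ := hkill a ha
  refine hsat a ha (p ^ e * n) (mul_ne_zero (pow_ne_zero _ hp.ne_zero) hn) ?_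
  rw [mul_nsmul', h, nsmul_add, ← map_nsmul, ← map_nsmul]
  exact M.add_mem (hMact _ _ hz₁) (hMact _ _ hz₂)

end Summit.BirchSwinnertonDyer.BirchSwinnertonDyer.Theorems.RamifiedSevenEllipticUnits.TwoGeneratorDescent
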